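import Summits.NavierStokesRegularity.NavierStokesRegularity.Theorems.StableStrataDoorSchema
import Summits.NavierStokesRegularity.NavierStokesRegularity.Theorems.StableStrataDoorFloorSurvives

/-!
# StableStrataDoorOneSliceSeqDoor — SEED-26 «the SEQUENTIAL ε-door» of door S26 «StableStrataDoor», CONSUMER part 1/2:
the generic sequential door PROVED modulo I1 (`StableStrataDoorOneSliceDefs.LocalPointZoomAlongTimesM`, the v5 form
`∀ ν, 0 < ν → ∀ M, ∃ c, …` of nsreg-p1 g21 ADDENDUM-25A; DIRECTOR-NS #82 (4))

S26 (`StableStrataDoor*`, ROUND-25) proves the ε-door of an analytic stratum from EVENTUAL smallness of a window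
observable (`∀ᶠ t → T⁻`, `StableStrataDoorSchema.StratumDoorAt`).  The sharper SEQUENTIAL door `SeqDoorAt Φ ν M`
(«`Φ ≤ ε` on the scale-normalised velocity along ONE sequence `tₙ → T⁻` is already impossible at a Type-I singular
point») needs a nontriviality certificate that survives two limits: Seregin's scale-invariant `L³`-FLOOR at the apex
(`StableStrataDoorOneSliceDefs.HasL3Floor`).  This file lands §2–§5 and the generic half of §8 of the nsreg-p1 design
`run/shared/lean/pub/ns-regularity-ideate/ns-regularity-ideate-p1/r25/seed26/Sketch26A.lean` (v5, sha16 bb69eb44dfa09fc3,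
818 l., farm rc 0 / 0 sorry), texts VERBATIM, with the S26 copies of §0 replaced by imports
(`StableStrataDoorDefs.physWindowField` / `profileWindowField`, `StableStrataDoorSchema.IsWindowLsc` / `SpreadsTo` /
`StratumDoorAt`), the §1 texts taken BY NAME from `StableStrataDoorOneSliceDefs` (I1 in the v5 form
`LocalPointZoomAlongTimesM`, I2a `FloorSurvives`), and I2a discharged by the tree theorem
`StableStrataDoorFloorSurvives.floorSurvives_holds` (nsreg-p6 g14):

* §2 texts: `OneSliceLiouville 𝔖 D` (one slice in the stratum ⇒ the classical Type-I(`D`) solution vanishes),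
  `OneSliceResidue Φ ν D c` (no classical Type-I(`D`) solution with the floor `c` has `Φ ≤ ε` on the window field of the
  slice at profile time `−1`), `SeqDoorAt Φ ν M` (the sequential ε-door at constants `(ν, M)`);
* §3 `windowLimit_at` (smallness of a zoom-closed `Φ` at the physical times `T + λ_j² s/ν` passes to the profile window
  field at profile time `s`), `not_hasL3Floor_of_eq_zero`, `tendsto_lam_zero`;
* §4 **`seqDoorAt_of`**: I1 + (H1) + the one-slice residue at `D = M/ν` ⇒ `SeqDoorAt Φ ν M`;
* §5 **`oneSliceResidue_of`**: (H1) + (H2) + the tree's `extraction` / `classical_limit` / `analytic_slices_of_decay`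
  (S25 `ZoomReturnDoor*`, `(−1/4)`-frame) + I2a + a one-slice stratum Liouville theorem ⇒ `OneSliceResidue Φ ν D c`;
* §8 **`seqDoorAt_of_liouville`**: I1 + (H1) + (H2) + `∀ D > 0, OneSliceLiouville 𝔖 D` ⇒ `SeqDoorAt Φ ν M` (I2a is the
  tree's theorem); `eventualDoor_of_seqDoor : SeqDoorAt Φ ν M → StratumDoorAt Φ ν M` (the sequential door implies
  S26's eventual door, same `ε`).

Part 2/2 (`StableStrataDoorOneSliceAxiSeq`) instantiates this at the axisymmetric stratum (door T-axi-seq) and the null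
stratum (door T-quiet-seq).  Door family of LADDER-NS N0 (door S26 / SEED-26; every file
`--supports stmt-NavierStokesRegularity-0056`, helper lane ns-door-S23-p1).  No route, no items.
WHAT THIS IS NOT: not NS regularity (Clay (A)) and not a dent in `NoTypeII` (stmt-0056) — a sequential ε-criterion
INSIDE the Type-I class, conditional on the typed input I1 (prescribed-scale local point zoom carrying the `L³`-floor,
nsreg-p6 lane); `ε` comes from compactness and is NOT explicit.
-/

noncomputable section

set_option linter.dupNamespace false

namespace Summit.NavierStokesRegularity.NavierStokesRegularity.Theorems.StableStrataDoorOneSliceSeqDoor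

open MeasureTheory Set Function Filter Topology TopologicalSpace Metric
open scoped RealInnerProductSpace NNReal ENNReal Topology Pointwise
open Literature.Analysis Literature.Analysis.FluidPDE
open Summit.NavierStokesRegularity.NavierStokesRegularity.Theorems.PoloidalWindowDoorPoloidalWindowRigidityWindow
open Summit.NavierStokesRegularity.NavierStokesRegularity.Theorems.ZoomReturnDoorDefs
open Summit.NavierStokesRegularity.NavierStokesRegularity.Theorems.ZoomReturnDoorRemovableFactors
open Summit.NavierStokesRegularity.NavierStokesRegularity.Theorems.ZoomReturnDoorGlue
open Summit.NavierStokesRegularity.NavierStokesRegularity.Theorems.ZoomReturnDoorExtraction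
open Summit.NavierStokesRegularity.NavierStokesRegularity.Theorems.ZoomReturnDoorClassicalLimit
open Summit.NavierStokesRegularity.NavierStokesRegularity.Theorems.StableStrataDoorDefs
open Summit.NavierStokesRegularity.NavierStokesRegularity.Theorems.StableStrataDoorWindowLimit
open Summit.NavierStokesRegularity.NavierStokesRegularity.Theorems.StableStrataDoorSchema
open Summit.NavierStokesRegularity.NavierStokesRegularity.Theorems.StableStrataDoorOneSliceDefs
open Summit.NavierStokesRegularity.NavierStokesRegularity.Theorems.StableStrataDoorFloorSurvives

variable (Φ : (EuclideanSpace ℝ (Fin 3) → EuclideanSpace ℝ (Fin 3)) → ℝ≥0∞)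
  (𝔖 : Set (EuclideanSpace ℝ (Fin 3) → EuclideanSpace ℝ (Fin 3)))


/-! ## §2 Generic texts of the sequential door (schema level, over `Φ`, `𝔖`) -/

/-- **one-slice stratum Liouville theorem** at decay `D`: a classical Type-I(`D`) solution on `(−∞,0) × ℝ³` with ONE
slice in the stratum vanishes identically. -/
def OneSliceLiouville (D : ℝ) : Prop :=
  ∀ (V : ℝ → EuclideanSpace ℝ (Fin 3) → EuclideanSpace ℝ (Fin 3)) (q : ℝ → EuclideanSpace ℝ (Fin 3) → ℝ),
    IsClassicalNSSolutionOn (Set.Iio 0) 1 0 V q → HasTypeIDecay D V → ∀ s₀ < 0, V s₀ ∈ 𝔖 → ∀ τ < 0, ∀ x, V τ x = 0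

/-- **one-slice residue** at `(ν, D)` with floor `c`: some `ε > 0` such that no classical Type-I(`D`) solution on
`(−∞,0) × ℝ³` with the `L³`-floor `c` at the apex has `Φ ≤ ε` on the window field of the slice at profile time `−1`. -/
def OneSliceResidue (ν D c : ℝ) : Prop :=
  ∃ ε : ℝ, 0 < ε ∧
    ∀ (u : ℝ → EuclideanSpace ℝ (Fin 3) → EuclideanSpace ℝ (Fin 3)) (p : ℝ → EuclideanSpace ℝ (Fin 3) → ℝ),
    IsClassicalNSSolutionOn (Set.Iio 0) 1 0 u p → HasTypeIDecay D u → HasL3Floor c u →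
    Φ (profileWindowField ν u (-1)) ≤ ENNReal.ofReal ε → False

/-- **the SEQUENTIAL ε-door** at constants `(ν, M)`: some `ε > 0` such that `Φ ≤ ε` on the scale-normalised velocity along
ANY sequence of times `tₙ → T⁻` excludes a singularity at `(x₀, T)` under space–time local Type I with constant `M`.
(Equivalent to the `∃ᶠ t → T⁻` form; strictly stronger than S26's `StratumDoorAt`, which needs `∀ᶠ`.) -/
def SeqDoorAt (ν M : ℝ) : Prop :=
  ∃ ε : ℝ, 0 < ε ∧ ∀ (T : ℝ), 0 < T →
    ∀ (u : ℝ → EuclideanSpace ℝ (Fin 3) → EuclideanSpace ℝ (Fin 3)) (p : ℝ → EuclideanSpace ℝ (Fin 3) → ℝ),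
    IsClassicalNSSolutionOn (Set.Ico 0 T) ν 0 u p → IsLerayHopfOn T ν 0 (u 0) u → HasRapidSpatialDecay (u 0) →
    ∀ (x₀ : EuclideanSpace ℝ (Fin 3)) (ρ : ℝ), 0 < ρ →
    (∀ t ∈ Set.Ico 0 T, T - ρ ^ 2 < t → ∀ x ∈ Metric.ball x₀ ρ, ‖u t x‖ * (‖x - x₀‖ + Real.sqrt (ν * (T - t))) ≤ M) →
    ∀ (t : ℕ → ℝ), (∀ n, t n < T) → Tendsto t atTop (𝓝 T) →
    (∀ n, Φ (physWindowField T x₀ u (t n)) ≤ ENNReal.ofReal ε) → IsBackwardBoundedAt u T x₀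

variable {Φ 𝔖}

/-! ## §3 Proved: the window limit at ONE profile time along a zoom -/

/-- **WINDOW LIMIT AT ONE PROFILE TIME:** along a velocity zoom with continuous limit slice at profile time `s`, smallness
of a zoom-closed `Φ` at the physical times `T + λ_j² s/ν` (eventually in `j`) passes to the profile window field at `s`. -/
theorem windowLimit_at (hlsc : IsWindowLsc Φ) {ν T : ℝ} {u : ℝ → EuclideanSpace ℝ (Fin 3) → EuclideanSpace ℝ (Fin 3)}
    {p : ℝ → EuclideanSpace ℝ (Fin 3) → ℝ} {x₀ : EuclideanSpace ℝ (Fin 3)}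
    {v : ℝ → EuclideanSpace ℝ (Fin 3) → EuclideanSpace ℝ (Fin 3)} {lam : ℕ → ℝ}
    (hν : 0 < ν) (hT : 0 < T) (hcl : IsClassicalNSSolutionOn (Ico 0 T) ν 0 u p)
    (hlam : ∀ j, 0 < lam j) (hlam0 : Tendsto lam atTop (𝓝 0))
    (hconv : ∀ s < 0, ∀ y,
      Tendsto (fun j => (lam j / ν) • u (T + lam j ^ 2 * s / ν) (x₀ + lam j • y)) atTop (𝓝 (v s y)))
    {ε s : ℝ} (hs : s < 0) (hvs : Continuous (v s))
    (hsmall : ∀ᶠ j in atTop, Φ (physWindowField T x₀ u (T + lam j ^ 2 * s / ν)) ≤ ENNReal.ofReal ε) :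
    Φ (profileWindowField ν v s) ≤ ENNReal.ofReal ε := by
  have hns : 0 < -s := neg_pos.2 hs
  obtain ⟨t, ht⟩ : ∃ t : ℕ → ℝ, ∀ j, t j = T + lam j ^ 2 * s / ν := ⟨_, fun j => rfl⟩
  have hTt : ∀ j, T - t j = lam j ^ 2 * (-s) / ν := fun j => by rw [ht j]; ring
  have hc : ∀ j, 0 < lam j ^ 2 * (-s) / ν := fun j => div_pos (mul_pos (pow_pos (hlam j) 2) hns) hν
  have hc0 : Tendsto (fun j => lam j ^ 2 * (-s) / ν) atTop (𝓝 0) := by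
    simpa using ((hlam0.pow 2).mul_const (-s)).div_const ν
  have htT : Tendsto t atTop (𝓝[<] T) := by
    refine tendsto_nhdsWithin_iff.2 ⟨?_, Eventually.of_forall fun j => ?_⟩
    · have h1 : Tendsto (fun j => T - lam j ^ 2 * (-s) / ν) atTop (𝓝 (T - 0)) :=
        tendsto_const_nhds.sub hc0
      rw [sub_zero] at h1
      refine h1.congr fun j => ?_
      rw [ht j]; ring
    · show t j < T
      have h1 := hc j
      rw [← hTt j] at h1
      linarith
  have hev : ∀ᶠ j in atTop, t j ∈ Set.Ioo 0 T := htT.eventually (Ioo_mem_nhdsLT hT)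
  obtain ⟨j₀, hj₀⟩ := eventually_atTop.1 hev
  have hshift : Tendsto (fun j : ℕ => j + j₀) atTop atTop := tendsto_add_atTop_nat j₀
  have hsmall' : ∀ᶠ j in atTop, Φ (physWindowField T x₀ u (t j)) ≤ ENNReal.ofReal ε :=
    hsmall.mono fun j hj => by rw [ht j]; exact hj
  have hsmallj : ∀ᶠ j in atTop, Φ (physWindowField T x₀ u (t (j + j₀))) ≤ ENNReal.ofReal ε := hshift.eventually hsmall'
  set σ : ℝ := Real.sqrt (-s) / Real.sqrt ν with hσ
  have hsq : ∀ j, Real.sqrt (T - t j) = lam j * σ := by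
    intro j
    rw [hTt j, hσ, Real.sqrt_div' _ hν.le, Real.sqrt_mul (pow_nonneg (hlam j).le 2), Real.sqrt_sq (hlam j).le]
    ring
  set W : ℕ → EuclideanSpace ℝ (Fin 3) → EuclideanSpace ℝ (Fin 3) := fun j y => physWindowField T x₀ u (t (j + j₀)) y
    with hWdef
  have hW : ∀ (j : ℕ) (y : EuclideanSpace ℝ (Fin 3)), W j y =
      (σ * ν) • ((lam (j + j₀) / ν) • u (T + lam (j + j₀) ^ 2 * s / ν) (x₀ + lam (j + j₀) • (σ • y))) := by
    intro j y
    simp only [hWdef, physWindowField, hsq (j + j₀), smul_smul]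
    rw [ht (j + j₀)]
    congr 1
    field_simp
  have hconvW : ∀ y, Tendsto (fun j => W j y) atTop (𝓝 (profileWindowField ν v s y)) := by
    intro y
    have h := ((hconv s hs (σ • y)).comp hshift).const_smul (σ * ν)
    have h' : Tendsto (fun j => W j y) atTop (𝓝 ((σ * ν) • v s (σ • y))) := h.congr fun j => (hW j y).symm
    simpa only [profileWindowField, hσ] using h'
  have hmem : ∀ j, t (j + j₀) ∈ Set.Ico 0 T := fun j =>
    ⟨(hj₀ (j + j₀) (Nat.le_add_left _ _)).1.le, (hj₀ (j + j₀) (Nat.le_add_left _ _)).2⟩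
  have hWc : ∀ j, Continuous (W j) := fun j => by
    show Continuous fun y => physWindowField T x₀ u (t (j + j₀)) y
    exact ((hcl.contDiff_velocity (hmem j)).continuous.comp
      (continuous_const.add (continuous_const_smul _))).const_smul (Real.sqrt (T - t (j + j₀)))
  have hWfun : ∀ j, W j = physWindowField T x₀ u (t (j + j₀)) := fun j => rfl
  have hle : Φ (profileWindowField ν v s) ≤ liminf (fun j => Φ (W j)) atTop :=
    hlsc W (profileWindowField ν v s) hWc (continuous_profileWindowField hvs) hconvW
  have hsmallW : ∀ᶠ j in atTop, Φ (W j) ≤ ENNReal.ofReal ε := by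
    filter_upwards [hsmallj] with j hj
    simpa only [hWfun] using hj
  exact hle.trans (liminf_le_of_frequently_le' hsmallW.frequently)


/-- the zero profile violates every positive floor. -/
theorem not_hasL3Floor_of_eq_zero {c : ℝ} (hc : 0 < c) {v : ℝ → EuclideanSpace ℝ (Fin 3) → EuclideanSpace ℝ (Fin 3)}
    (h : ∀ s < 0, ∀ z, v s z = 0) : ¬ HasL3Floor c v := by
  intro hfloor
  have h1 := hfloor 1 one_pos
  have hS : MeasurableSet (parabolicCylinder (1 : ℝ) (0 : ℝ × EuclideanSpace ℝ (Fin 3))) := by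
    unfold parabolicCylinder
    exact measurableSet_Ioo.prod Metric.isOpen_ball.measurableSet
  have hae : (fun z : ℝ × EuclideanSpace ℝ (Fin 3) => ENNReal.ofReal (‖uncurry v z‖ ^ 3))
      =ᵐ[volume.restrict (parabolicCylinder (1 : ℝ) (0 : ℝ × EuclideanSpace ℝ (Fin 3)))] (fun _ => 0) := by
    refine (ae_restrict_iff' hS).2 (Filter.Eventually.of_forall ?_)
    rintro ⟨s, z⟩ hq
    have hq' := (Set.mem_prod.1 hq).1
    simp only [Set.mem_Ioo] at hq'
    have hs : s < 0 := by simpa using hq'.2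
    simp [Function.uncurry, h s hs z]
  rw [lintegral_congr_ae hae, lintegral_zero] at h1
  have h0 : ENNReal.ofReal (c * 1 ^ 2) = 0 := le_antisymm h1 bot_le
  rw [ENNReal.ofReal_eq_zero] at h0
  linarith

/-- the scales of a zoom along times `tₙ → T⁻` tend to zero. -/
theorem tendsto_lam_zero {ν T : ℝ} {t : ℕ → ℝ} {φ : ℕ → ℕ} {lam : ℕ → ℝ} (hφ : StrictMono φ)
    (ht : Tendsto t atTop (𝓝 T)) (hlam : ∀ j, 0 < lam j) (hlam2 : ∀ j, lam j ^ 2 = ν * (T - t (φ j))) :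
    Tendsto lam atTop (𝓝 0) := by
  have h1 : Tendsto (fun j => ν * (T - t (φ j))) atTop (𝓝 (ν * (T - T))) :=
    (tendsto_const_nhds.sub (ht.comp hφ.tendsto_atTop)).const_mul ν
  rw [sub_self, mul_zero] at h1
  have h2 : Tendsto (fun j => Real.sqrt (ν * (T - t (φ j)))) atTop (𝓝 (Real.sqrt 0)) := h1.sqrt
  rw [Real.sqrt_zero] at h2
  refine h2.congr fun j => ?_
  rw [← hlam2 j, Real.sqrt_sq (hlam j).le]

/-! ## §4 Proved: the sequential door from I1 and the one-slice residue -/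

/-- **THE SEQUENTIAL DOOR (generic logic, PROVED):** I1 + (H1) + the one-slice residue at `D = M/ν` (for I1's floor
constant) ⇒ `SeqDoorAt Φ ν M`. -/
theorem seqDoorAt_of (h₁ : LocalPointZoomAlongTimesM) (hlsc : IsWindowLsc Φ) {ν M : ℝ} (hν : 0 < ν)
    (h₂ : ∀ c : ℝ, 0 < c → 0 < M / ν → OneSliceResidue Φ ν (M / ν) c) : SeqDoorAt Φ ν M := by
  obtain ⟨c, hc, hzoom⟩ := h₁ ν hν M
  rcases le_or_gt (M / ν) 0 with hD | hD
  · refine ⟨1, one_pos, fun T hT u p hcl hLH hdec x₀ ρ hρ hM t htT ht _ => ?_⟩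
    by_contra hnot
    obtain ⟨φ, C, v, lam, hφ, hlam, hlam2, _, hfloor, hconv⟩ :=
      hzoom T hT u p hcl hLH hdec x₀ ρ hρ hM hnot t htT ht
    have hdecay : HasTypeIDecay (M / ν) v :=
      Summit.NavierStokesRegularity.NavierStokesRegularity.Theorems.PlaneStrainDoorZoomSpaceTimeDecay.hasTypeIDecay_of_zoom
        hν hT hρ hlam (tendsto_lam_zero hφ ht hlam hlam2) hM hconv
    exact not_hasL3Floor_of_eq_zero hc (eq_zero_of_decay_nonpos hD hdecay) hfloor
  · obtain ⟨ε, hε, hres⟩ := h₂ c hc hD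
    refine ⟨ε, hε, fun T hT u p hcl hLH hdec x₀ ρ hρ hM t htT ht hgood => ?_⟩
    by_contra hnot
    obtain ⟨φ, C, v, lam, hφ, hlam, hlam2, hcls, hfloor, hconv⟩ :=
      hzoom T hT u p hcl hLH hdec x₀ ρ hρ hM hnot t htT ht
    have hlam0 : Tendsto lam atTop (𝓝 0) := tendsto_lam_zero hφ ht hlam hlam2
    have hdecay : HasTypeIDecay (M / ν) v :=
      Summit.NavierStokesRegularity.NavierStokesRegularity.Theorems.PlaneStrainDoorZoomSpaceTimeDecay.hasTypeIDecay_of_zoom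
        hν hT hρ hlam hlam0 hM hconv
    obtain ⟨hrate, hcont, hmild, hdiv⟩ := hcls
    have hmildcls : IsTypeIAncientMild C v := isTypeIAncientMild_of_class hrate hcont hmild hdiv
    obtain ⟨q, hclv⟩ :=
      Summit.NavierStokesRegularity.NavierStokesRegularity.Theorems.exists_isClassicalNSSolutionOn_Iio_of_isTypeIAncientMild
        hmildcls
    have hm1 : (-1 : ℝ) < 0 := by norm_num
    have htime : ∀ j, T + lam j ^ 2 * (-1) / ν = t (φ j) := by
      intro j
      rw [hlam2 j]
      field_simp
      ring
    have hsmall : ∀ᶠ j in atTop, Φ (physWindowField T x₀ u (T + lam j ^ 2 * (-1) / ν)) ≤ ENNReal.ofReal ε :=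
      Eventually.of_forall fun j => by rw [htime j]; exact hgood (φ j)
    have hwin : Φ (profileWindowField ν v (-1)) ≤ ENNReal.ofReal ε :=
      windowLimit_at hlsc hν hT hcl hlam hlam0 hconv hm1 (continuous_slice_of_continuousOn hcont hm1) hsmall
    exact hres v q hclv hdecay hfloor hwin

/-! ## §5 Proved: the one-slice residue from (H1), (H2), I2a and the one-slice Liouville theorem -/

/-- **THE ONE-SLICE RESIDUE (PROVED):** (H1) + (H2) + the tree's extraction / classical limit (S25) + I2a + the one-slice
stratum Liouville theorem ⇒ `OneSliceResidue Φ ν D c`. -/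
theorem oneSliceResidue_of {ν D c : ℝ} (hD : 0 < D) (hlsc : IsWindowLsc Φ) (hspread : SpreadsTo Φ 𝔖 ν)
    (hsurv : FloorSurvives D c) (hLiou : OneSliceLiouville 𝔖 D) : OneSliceResidue Φ ν D c := by
  by_contra hbad
  have hbad' : ∀ ε : ℝ, 0 < ε → ∃ (u : ℝ → EuclideanSpace ℝ (Fin 3) → EuclideanSpace ℝ (Fin 3))
      (p : ℝ → EuclideanSpace ℝ (Fin 3) → ℝ), IsClassicalNSSolutionOn (Iio 0) 1 0 u p ∧ HasTypeIDecay D u ∧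
      HasL3Floor c u ∧ Φ (profileWindowField ν u (-1)) ≤ ENNReal.ofReal ε := by
    by_contra hno
    push Not at hno
    obtain ⟨ε, hε, hall⟩ := hno
    exact hbad ⟨ε, hε, fun u p hcl hdec hfl hsm => absurd hsm (not_le.2 (hall u p hcl hdec hfl))⟩
  have hseq : ∀ n : ℕ, ∃ (w : ℝ → EuclideanSpace ℝ (Fin 3) → EuclideanSpace ℝ (Fin 3)) (q : ℝ → EuclideanSpace ℝ (Fin 3) → ℝ),
      IsClassicalNSSolutionOn (Iio 0) 1 0 w q ∧ HasTypeIDecay D w ∧ HasL3Floor c w ∧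
      Φ (profileWindowField ν w (-1)) ≤ ENNReal.ofReal (1 / ((n : ℝ) + 1)) := fun n =>
    hbad' (1 / ((n : ℝ) + 1)) (by positivity)
  choose vn qn hcl hdec hfl hsm using hseq
  -- the tree's extraction (no floor witnesses needed: `η = 0`) and classical limit in the `(−1/4)`-frame
  have hx : ∀ n : ℕ, ‖(fun _ : ℕ => (0 : EuclideanSpace ℝ (Fin 3))) n‖ ≤ 0 := fun n => by simp
  have hη : ∀ n : ℕ, (0 : ℝ) ≤ ‖vn n (-1) ((fun _ : ℕ => (0 : EuclideanSpace ℝ (Fin 3))) n)‖ := fun n => norm_nonneg _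
  obtain ⟨φ, v, hφ, hvc, hbw, hlu, hdecv, _, _⟩ := extraction (T := -1) hD le_rfl hcl hdec hx hη
  obtain ⟨q, hclv⟩ := classical_limit hD hvc hbw hdecv
  obtain ⟨hL, hD'⟩ := bounds_of_decay hD hdecv
  have han := analytic_slices_of_decay hclv hL hD'
  have hcc := tendsto_of_locUnif hlu strictMono_id
  have hpt : ∀ t < -(1 / 4 : ℝ), ∀ y, Tendsto (fun n => vn (φ n) t y) atTop (𝓝 (v t y)) := by
    intro t ht y
    have h := hcc t ht y (fun _ => t) (fun _ => y) tendsto_const_nhds tendsto_const_nhds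
    simpa using h
  have hm1 : (-1 : ℝ) < -(1 / 4 : ℝ) := by norm_num
  have hm10 : (-1 : ℝ) < 0 := by norm_num
  have hεn : Tendsto (fun n => 1 / (((φ n : ℕ) : ℝ) + 1)) atTop (𝓝 0) :=
    (tendsto_one_div_add_atTop_nhds_zero_nat (𝕜 := ℝ)).comp hφ.tendsto_atTop
  have hslice : ∀ n, ∀ t < 0, Continuous (vn (φ n) t) := fun n t ht =>
    ((hcl (φ n)).contDiff_velocity (by exact ht)).continuous
  have hvslice : ∀ t : ℝ, Continuous (v t) := fun t => hvc.comp (Continuous.prodMk_right t)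
  -- (H1): `Φ = 0` on the window field of the limit slice at profile time `−1`
  have hzero : Φ (profileWindowField ν v (-1)) = 0 := by
    have hle : Φ (profileWindowField ν v (-1)) ≤ liminf (fun n => Φ (profileWindowField ν (vn (φ n)) (-1))) atTop :=
      hlsc (fun n => profileWindowField ν (vn (φ n)) (-1)) (profileWindowField ν v (-1))
        (fun n => continuous_profileWindowField (hslice n (-1) hm10)) (continuous_profileWindowField (hvslice (-1)))
        (fun y => (hpt (-1) hm1 _).const_smul _)
    have hbound : ∀ᶠ n in atTop, Φ (profileWindowField ν (vn (φ n)) (-1)) ≤ ENNReal.ofReal (1 / (((φ n : ℕ) : ℝ) + 1)) :=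
      Eventually.of_forall fun n => hsm (φ n)
    have hε0 : liminf (fun n => ENNReal.ofReal (1 / (((φ n : ℕ) : ℝ) + 1))) atTop = 0 := by
      rw [(ENNReal.tendsto_ofReal hεn).liminf_eq, ENNReal.ofReal_zero]
    exact le_antisymm ((hle.trans (liminf_le_liminf hbound)).trans hε0.le) bot_le
  -- (H2): the limit slice at `−1` lies in the stratum
  have hstrat : v (-1) ∈ 𝔖 := hspread v (-1) hm10 (han (-1) hm1) hzero
  -- time shift and the one-slice Liouville theorem
  set V : ℝ → EuclideanSpace ℝ (Fin 3) → EuclideanSpace ℝ (Fin 3) := fun τ => v (τ + -(1 / 4 : ℝ)) with hV_def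
  have hVcl : IsClassicalNSSolutionOn (Iio 0) 1 0 V (fun τ => q (τ + -(1 / 4 : ℝ))) := by
    have h1 := hclv.comp_add_right (-(1 / 4 : ℝ))
    have hS : (fun τ : ℝ => τ + -(1 / 4 : ℝ)) ⁻¹' Iio (-(1 / 4 : ℝ)) = Iio 0 := by
      ext τ
      simp only [mem_preimage, mem_Iio]
      constructor <;> intro h <;> linarith
    rw [hS] at h1
    exact h1
  have hVdec : HasTypeIDecay D V := by
    intro τ hτ y
    have h1 := hdecv (τ + -(1 / 4 : ℝ)) (by linarith) y
    have hpos : 0 < ‖y‖ + Real.sqrt (-τ) := by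
      have := Real.sqrt_pos.2 (neg_pos.2 hτ); positivity
    have hsqrt : Real.sqrt (-τ) ≤ Real.sqrt (-(τ + -(1 / 4 : ℝ))) := Real.sqrt_le_sqrt (by linarith)
    calc ‖V τ y‖ = ‖v (τ + -(1 / 4 : ℝ)) y‖ := rfl
      _ ≤ D / (‖y‖ + Real.sqrt (-(τ + -(1 / 4 : ℝ)))) := h1
      _ ≤ D / (‖y‖ + Real.sqrt (-τ)) := div_le_div_of_nonneg_left hD.le hpos (by linarith)
  have hVmem : V (-(3 / 4 : ℝ)) ∈ 𝔖 := by
    have h34 : V (-(3 / 4 : ℝ)) = v (-1) := by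
      simp only [hV_def]
      norm_num
    rw [h34]
    exact hstrat
  have hV0 := hLiou V _ hVcl hVdec (-(3 / 4 : ℝ)) (by norm_num) hVmem
  have hv0 : ∀ s < -(1 / 4 : ℝ), ∀ y, v s y = 0 := by
    intro s hs y
    have h := hV0 (s + 1 / 4) (by linarith) y
    simp only [hV_def] at h
    rwa [show s + 1 / 4 + -(1 / 4 : ℝ) = s by ring] at h
  -- I2a: the floor survives, contradiction
  have hcont : ∀ n, ContinuousOn (uncurry (vn (φ n))) (Set.Iio (0 : ℝ) ×ˢ Set.univ) := fun n =>
    (hcl (φ n)).smooth_velocity.continuousOn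
  refine hsurv (fun n => vn (φ n)) hcont (fun n => hdec (φ n)) (fun n => hfl (φ n)) fun s hs y => ?_
  have h := hpt s hs y
  rwa [hv0 s hs y] at h

/-! ## §8 (generic half) The sequential door with ONE analytic input per stratum; the eventual door -/

/-- **The generic sequential door with ONE analytic input per stratum:** I1 + (H1) + (H2) + a one-slice stratum Liouville
theorem ⇒ `SeqDoorAt Φ ν M` (the floor-survival lemma I2a is the tree's `StableStrataDoorFloorSurvives.floorSurvives_holds`). -/
theorem seqDoorAt_of_liouville {ν M : ℝ} (hν : 0 < ν) (h₁ : LocalPointZoomAlongTimesM) (hlsc : IsWindowLsc Φ)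
    (hspread : SpreadsTo Φ 𝔖 ν) (hLiou : ∀ D : ℝ, 0 < D → OneSliceLiouville 𝔖 D) : SeqDoorAt Φ ν M :=
  seqDoorAt_of h₁ hlsc hν fun _ hc hD =>
    oneSliceResidue_of hD hlsc hspread (floorSurvives_holds hc) (hLiou (M / ν) hD)



/-- sanity: EVENTUAL smallness (S26's hypothesis) gives smallness along the canonical sequence `T − T/(n+2) → T⁻`, so the
sequential door `SeqDoorAt` implies S26's eventual door `StratumDoorAt` (with the same `ε`). -/
theorem eventually_small_along_seq {Φ : (EuclideanSpace ℝ (Fin 3) → EuclideanSpace ℝ (Fin 3)) → ℝ≥0∞}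
    {T : ℝ} (hT : 0 < T) {x₀ : EuclideanSpace ℝ (Fin 3)} {u : ℝ → EuclideanSpace ℝ (Fin 3) → EuclideanSpace ℝ (Fin 3)}
    {ε : ℝ} (h : ∀ᶠ t in nhdsWithin T (Set.Iio T), Φ (physWindowField T x₀ u t) ≤ ENNReal.ofReal ε) :
    ∃ t : ℕ → ℝ, (∀ n, t n < T) ∧ Tendsto t atTop (𝓝 T) ∧ ∀ n, Φ (physWindowField T x₀ u (t n)) ≤ ENNReal.ofReal ε := by
  have hpos : ∀ n : ℕ, 0 < T / ((n : ℝ) + 2) := fun n => by positivity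
  have h1 : Tendsto (fun n : ℕ => T / ((n : ℝ) + 2)) atTop (𝓝 0) :=
    tendsto_const_nhds.div_atTop (tendsto_atTop_add_const_right _ _ tendsto_natCast_atTop_atTop)
  have hlim : Tendsto (fun n : ℕ => T - T / ((n : ℝ) + 2)) atTop (𝓝 T) := by simpa using tendsto_const_nhds.sub h1
  have htT : Tendsto (fun n : ℕ => T - T / ((n : ℝ) + 2)) atTop (𝓝[<] T) :=
    tendsto_nhdsWithin_iff.2 ⟨hlim, Eventually.of_forall fun n => by
      show T - T / ((n : ℝ) + 2) < T
      linarith [hpos n]⟩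
  obtain ⟨N, hN⟩ := eventually_atTop.1 (htT.eventually h)
  refine ⟨fun n => T - T / (((n + N : ℕ) : ℝ) + 2), fun n => by linarith [hpos (n + N)],
    hlim.comp (tendsto_add_atTop_nat N), fun n => hN (n + N) (Nat.le_add_left _ _)⟩


/-- **COROLLARY (PROVED): the sequential door implies S26's eventual door** `StableStrataDoorSchema.StratumDoorAt Φ ν M`
(with the same `ε`): EVENTUAL smallness gives smallness along the canonical sequence `T − T/(n+2) → T⁻`. -/
theorem eventualDoor_of_seqDoor {ν M : ℝ} (h : SeqDoorAt Φ ν M) : StratumDoorAt Φ ν M := by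
  obtain ⟨ε, hε, hdoor⟩ := h
  refine ⟨ε, hε, fun T hT u p hcl hLH hdec x₀ ρ hρ hM hsmall => ?_⟩
  obtain ⟨t, htT, ht, hgood⟩ := eventually_small_along_seq (Φ := Φ) hT hsmall
  exact hdoor T hT u p hcl hLH hdec x₀ ρ hρ hM t htT ht hgood

end Summit.NavierStokesRegularity.NavierStokesRegularity.Theorems.StableStrataDoorOneSliceSeqDoor
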